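import Summits.QuantumFields.YangMills.Theorems.BalabanUVNodesN21ThresholdMixtureRecordChi
import Literature.MathematicalPhysics.QuantumFieldTheory.Balaban1983to89.B14Sect3Decomp

/-!
# YM-DAG node N21 (= NE7c) — THE THRESHOLD MIXTURE, PART 7a: the 𝐓-operation's (3.2)·(3.3) characteristic functions of
# [Balaban1988Convergent] p. 265 as PER-CUBE-THRESHOLD MIXED-POLARITY SHARP SLOT PRODUCTS, and their common-box averages

Track A of `YM-PLAN.md` (cell `pub-ymgap`, HUMAN RULING D-0062), node **N21**; R141 (C) fan-out seat `pub-ymgap-dag-n21-e` (s3 = ALTERNATIVE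
CURRENCY), generation 5, file 14a.  Companions: file 13a `…N21ThresholdMixtureRecordChi` (p491254: the (2.17) generation-`k` small-field function
is the diagonal of a per-cube-threshold SHARP product of `T4IndicatorShell.smallInd` at the block-sup tested variable; its common-box threshold
average is design (η)'s profiled product), file 5a `…N21ThresholdMixture` (p466893: `integral_fac_smallInd`), r11's `Lit/B14Sect3Decomp.lean`
(the (3.2)∕(3.3) decompositions of unity of the 𝐓-operation, WITH BODY).  Kernel bookkeeping: 0 `def`, 0 `sorry`, standard axioms.  COUNT-NEUTRAL;
`--supports` the K3‴ item `SpineGivenEndpointR13` (stmt-QuantumFields-19912) as a helper.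

WHAT THIS FILE DOES.  The mixture road (files 5a–13b) reads every background-mediated characteristic function of a term as a SHARP slot factor
`(pol).fac (smallInd u s)` — `u` a threshold-free tested variable, `s` the slot's OWN threshold coordinate, `pol` its polarity (small-field `χ` or
large-field `1 − χ`) — and averages the threshold vector over the COMMON BOX of one multiplier per occurrence.  Files 13a∕13b typed this for the
FRONT factor `χ_k(Ω_k)` of (2.17)∕(2.18) (pure small polarity).  The 𝐓-operation (3.1) inserts TWO MORE decompositions of unity, (3.2) and (3.3)
p. 265, whose characteristic functions r11 types WITH BODY and explicit thresholds:
* (3.2) `chiNext D ε X V = ∏_{□′∈X} χ({sup_{p ⊂ □′^∼}|U_{k+1,□′}(V)(∂p) − 1| < ε_{k+1}η²})`, `chiNextc` its complement product;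
* (3.3) `chiPrime D av (2δ_k) X V_k V = ∏_{□′∈X} 𝟙[SmallApproxFluct … □′]`, `SmallApproxFluct D av (2δ) V_k V □′ ⟺ ∀ b ∈ (□′^{∼2})^{(k)*},
  |V_k(b)(V^{(k)}_{□′}(b))⁻¹ − 1| < 2δ`, `chiPrimec` its complement product.
§1 (any finite occurrence type): the MIXED-POLARITY sharp product `∏_{c∈A} (pol c).fac (smallInd (u c) (S c))` — values in `[0,1]`, joint
measurability, the label-product identity `(∏_{C∖X} f)(∏_X (1 − f)) = ∏_C (polOf X c).fac (f c)`, the DECOMPOSITION OF UNITY and the PINNED-CUBE class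
sum AT EVERY THRESHOLD VECTOR (`Σ_{X⊆C} … = 1`, `Σ_{X⊆C, c∈X} … = 1 − smallInd (u c) (S c)`: the E1∕E2 input of file 12's `classSum_eq_of_sharpCommonBox`
and N20's `hbad` shape, uniform over the common box), and ★ the COMMON-BOX AVERAGE `= ∏_{c∈A} (pol c).fac (linProfile κ_c (u_c∕θ_c))` (13a's
`commonBox_average_prod_smallInd_eq` for mixed polarities) with its Fubini form against any integrable remainder (the `hXs`∕`hA` pair).
§2 (r11's `Sect3Data` letters, any gauge group): ★ the (3.3) condition IS `u′ < 2δ` for the FINITE BOND-SUP tested variable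
`u′_{□′}(V_k, V) = ⨆_{b ∈ bondsStar □′} dist1 (V_k b · (Vbox D av □′ V b)⁻¹)` (`0 < 2δ`), so `chiPrime = ∏ smallInd (u′ ·) (2δ)`, `chiPrimec = ∏ (1 − …)`,
and the (3.3) label weight `χ′(C∖Q)·χ′ᶜ(Q)` IS THE DIAGONAL `S ≡ 2δ` of the mixed sharp product; the (3.2) twins at 13a's block-sup; measurability of
`u′` from the displayed measurability of the field maps.

HONEST FRAMING.  NE7c is NOT PRINTED and NOT PROVED.  This file is currency: identities about r11's typed objects with the per-cube threshold made
an explicit vector argument; the mixture (a convex combination of print's SHARP procedure over admissible threshold vectors) is design, NOT print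
verbatim; the residual (3.16)∕(3.20)∕(3.21) characteristic functions of the fluctuation field have no body in the tree and are not touched; nothing of
Bałaban's is asserted; N21 NOT discharged; count-neutral; one finite four-torus programme at fixed `ε`; NOT continuum ∕ ℝ⁴ ∕ OS ∕ mass gap ∕ Clay.

CITATION HEADER (lean-in-tree rule 2026-08-18).  BY NAME: r11 `B14.Sect3Decomp.chiNext` ∕ `chiNextc` ∕ `chiPrime` ∕ `chiPrimec` ∕ `SmallApproxFluct` ∕
`Vbox` ([Balaban1988Convergent] (3.2)–(3.4) p. 265, typed there with locators); 13a `chiSmall_eq_smallInd_iSup` ∕ `integral_one_window`; 5a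
`integral_fac_smallInd`; `T4IndicatorShell.smallInd`; `T4LipschitzCutoff.linProfile`; `T4LipschitzLedger.Pol`.  Context only (SHAPE): [Balaban1988Convergent]
(3.2)–(3.3) p. 265 — *"1 = Σ_{P_{k+1}} χ_{k+1}(Pᶜ_{k+1}) χᶜ_{k+1}(P_{k+1})"*, *"1 = Σ_{Q_{k+1}} χ′_k(Qᶜ_{k+1}) χ′ᶜ_k(Q_{k+1})"*.

WHAT IS PROVED ([folklore] unless cited).  §1 `prod_fac_smallInd_mem_unitInterval` · `prod_sdiff_mul_prod_eq_prod_fac` · `sum_ite_subset_prod_smallInd_eq_one` ·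
`sum_ite_mem_prod_smallInd_eq` · `measurable_prod_fac_smallInd_eval` · `integrable_commonBox_fac_integrand` · ★ `commonBox_average_prod_fac_smallInd_eq` ·
★ `commonBox_average_facWeight_eq`; §2 `iSup_dist1_bond_nonneg` · `dist1_le_iSup_dist1_bond` · ★ `smallApproxFluct_iff_iSup_lt` · ★ `chiPrime_eq_prod_smallInd` ·
`chiPrimec_eq_prod_one_sub_smallInd` · ★ `chiPrime_sdiff_mul_chiPrimec_eq_prod_fac` · `chiNext_eq_prod_smallInd_iSup` · `chiNextc_eq_prod_one_sub_smallInd_iSup` ·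
★ `chiNext_sdiff_mul_chiNextc_eq_prod_fac` · `measurable_iSup_dist1_bond`.
-/

set_option autoImplicit false

noncomputable section

open MeasureTheory Set
open scoped BigOperators ENNReal

namespace Summit.QuantumFields.YangMills.Theorems.N21ThresholdMixtureTStepChi

open Literature.MathematicalPhysics.QuantumFieldTheory.Balaban1983to89
open Literature.MathematicalPhysics.QuantumFieldTheory.Balaban1983to89.T4IndicatorShell
open Literature.MathematicalPhysics.QuantumFieldTheory.Balaban1983to89.T4LipschitzCutoff
open Literature.MathematicalPhysics.QuantumFieldTheory.Balaban1983to89.T4LipschitzLedger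
open Summit.QuantumFields.YangMills.Theorems.N21ThresholdMixture (integral_fac_smallInd)
open Summit.QuantumFields.YangMills.Theorems.N21ThresholdMixtureRecordChi

/-! ## §1 Mixed-polarity per-cube-threshold sharp products over a finite occurrence type -/

section MixedPolarity

variable {ι : Type*}

/-- A mixed-polarity sharp product `∏_{c∈A} (pol c).fac (1[u_c < S_c])` lies in `[0, 1]`. [folklore] -/
theorem prod_fac_smallInd_mem_unitInterval (A : Finset ι) (pol : ι → Pol) (u S : ι → ℝ) :
    0 ≤ ∏ c ∈ A, (pol c).fac (smallInd (u c) (S c)) ∧ ∏ c ∈ A, (pol c).fac (smallInd (u c) (S c)) ≤ 1 :=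
  ⟨Finset.prod_nonneg fun c _ => Pol.fac_nonneg (smallInd_nonneg _ _) (smallInd_le_one _ _) (pol c),
    Finset.prod_le_one (fun c _ => Pol.fac_nonneg (smallInd_nonneg _ _) (smallInd_le_one _ _) (pol c))
      fun c _ => Pol.fac_le_one (smallInd_nonneg _ _) (smallInd_le_one _ _) (pol c)⟩

/-- **THE LABEL PRODUCT IS ONE `Pol.fac` PRODUCT.**  For a label `X ⊆ C` and any factor family `f` (print: `f □′ = χ(□′)`, the (3.2)∕(3.3) label weight
`χ(C∖X)·χᶜ(X)`): `(∏_{c ∈ C∖X} f c)·(∏_{c ∈ X} (1 − f c)) = ∏_{c ∈ C} (if c ∈ X then large else small).fac (f c)` — every cube of the range is ONE slot,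
small-field off the label and large-field on it. [folklore] -/
theorem prod_sdiff_mul_prod_eq_prod_fac [DecidableEq ι] {C X : Finset ι} (hX : X ⊆ C) (f : ι → ℝ) :
    (∏ c ∈ C \ X, f c) * ∏ c ∈ X, (1 - f c) = ∏ c ∈ C, (if c ∈ X then Pol.large else Pol.small).fac (f c) := by
  rw [← Finset.prod_sdiff hX]
  congr 1
  · refine Finset.prod_congr rfl fun c hc => ?_
    rw [if_neg (Finset.mem_sdiff.1 hc).2, Pol.fac_small]
  · refine Finset.prod_congr rfl fun c hc => ?_
    rw [if_pos hc, Pol.fac_large]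

/-- **THE (3.2)∕(3.3)-TYPE DECOMPOSITION OF UNITY HOLDS AT EVERY THRESHOLD VECTOR.**  For any tested values `u` and ANY threshold vector `S`:
`Σ_X [X ⊆ C]·(∏_{C∖X} 1[u_c < S_c])·(∏_X (1 − 1[u_c < S_c])) = 1` (`Finset.prod_add`, r11's `eq32`∕`eq33` being the diagonal `S ≡ const`) — the input
«sharp decomposition of unity at every threshold assignment» of file 12's `classSum_eq_of_sharpCommonBox` for label structures of this type. [folklore] -/
theorem sum_ite_subset_prod_smallInd_eq_one [Fintype ι] [DecidableEq ι] (C : Finset ι) (u S : ι → ℝ) :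
    (∑ X : Finset ι, if X ⊆ C then (∏ c ∈ C \ X, smallInd (u c) (S c)) * ∏ c ∈ X, (1 - smallInd (u c) (S c)) else 0) = 1 := by
  rw [← Finset.sum_filter]
  have hfilter : (Finset.univ.filter fun X : Finset ι => X ⊆ C) = C.powerset := by ext X; simp
  rw [hfilter]
  calc ∑ X ∈ C.powerset, (∏ c ∈ C \ X, smallInd (u c) (S c)) * ∏ c ∈ X, (1 - smallInd (u c) (S c))
      = ∑ X ∈ C.powerset, (∏ c ∈ X, (1 - smallInd (u c) (S c))) * ∏ c ∈ C \ X, smallInd (u c) (S c) :=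
        Finset.sum_congr rfl fun _ _ => mul_comm _ _
    _ = ∏ c ∈ C, ((1 - smallInd (u c) (S c)) + smallInd (u c) (S c)) := (Finset.prod_add _ _ _).symm
    _ = 1 := Finset.prod_eq_one fun c _ => by ring

/-- **THE PINNED-CUBE CLASS SUM AT EVERY THRESHOLD VECTOR** (N20's `hbad` shape in print's currency, uniform over the common box): for a cube `c`,
`Σ_X [c ∈ X]·[X ⊆ C]·(∏_{C∖X} 1[u < S])·(∏_X (1 − 1[u < S])) = [c ∈ C]·(1 − 1[u_c < S_c])` — the labels pinning `c` as large-field carry EXACTLY the cube's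
large-field factor at its own threshold coordinate, the decomposition of unity of `C ∖ {c}` summing to `1`. [folklore] -/
theorem sum_ite_mem_prod_smallInd_eq [Fintype ι] [DecidableEq ι] (C : Finset ι) (u S : ι → ℝ) (c : ι) :
    (∑ X : Finset ι, if c ∈ X then
        (if X ⊆ C then (∏ c' ∈ C \ X, smallInd (u c') (S c')) * ∏ c' ∈ X, (1 - smallInd (u c') (S c')) else 0) else 0) =
      if c ∈ C then 1 - smallInd (u c) (S c) else 0 := by
  -- split off the factor of `c`: on labels containing `c` the product carries `(1 − 1[u_c < S_c])` times the decomposition of unity of `C.erase c`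
  by_cases hc : c ∈ C
  · rw [if_pos hc]
    have key : ∀ X : Finset ι,
        (if c ∈ X then (if X ⊆ C then (∏ c' ∈ C \ X, smallInd (u c') (S c')) * ∏ c' ∈ X, (1 - smallInd (u c') (S c')) else 0)
          else (0 : ℝ)) =
        (1 - smallInd (u c) (S c)) *
          (if (X.erase c ⊆ C.erase c ∧ c ∈ X) then
            (∏ c' ∈ C.erase c \ X.erase c, smallInd (u c') (S c')) * ∏ c' ∈ X.erase c, (1 - smallInd (u c') (S c')) else 0) := by
      intro X
      by_cases hcX : c ∈ X
      · rw [if_pos hcX]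
        by_cases hXC : X ⊆ C
        · have h1 : X.erase c ⊆ C.erase c := Finset.erase_subset_erase c hXC
          rw [if_pos hXC, if_pos ⟨h1, hcX⟩]
          have hsd : C.erase c \ X.erase c = C \ X := by
            ext x
            simp only [Finset.mem_sdiff, Finset.mem_erase]
            constructor
            · rintro ⟨⟨hx1, hx2⟩, hx3⟩
              exact ⟨hx2, fun hx => hx3 ⟨hx1, hx⟩⟩
            · rintro ⟨hx1, hx2⟩
              exact ⟨⟨fun h => hx2 (h ▸ hcX), hx1⟩, fun h => hx2 h.2⟩
          rw [hsd, ← Finset.mul_prod_erase X (fun c' => 1 - smallInd (u c') (S c')) hcX]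
          ring
        · rw [if_neg hXC, if_neg, mul_zero]
          rintro ⟨h1, -⟩
          exact hXC fun x hx => by
            by_cases hxc : x = c
            · exact hxc ▸ hc
            · exact Finset.mem_of_mem_erase (h1 (Finset.mem_erase.2 ⟨hxc, hx⟩))
      · rw [if_neg hcX, if_neg (fun h => hcX h.2), mul_zero]
    simp_rw [key]
    rw [← Finset.mul_sum]
    -- the remaining sum is the decomposition of unity of `C.erase c`, re-indexed by `X ↦ X.erase c` on the labels containing `c`
    have hre : (∑ X : Finset ι, if (X.erase c ⊆ C.erase c ∧ c ∈ X) then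
          (∏ c' ∈ C.erase c \ X.erase c, smallInd (u c') (S c')) * ∏ c' ∈ X.erase c, (1 - smallInd (u c') (S c')) else (0 : ℝ)) =
        ∑ Y : Finset ι, if Y ⊆ C.erase c then
          (∏ c' ∈ C.erase c \ Y, smallInd (u c') (S c')) * ∏ c' ∈ Y, (1 - smallInd (u c') (S c')) else 0 := by
      rw [← Finset.sum_filter, ← Finset.sum_filter]
      refine Finset.sum_nbij' (fun X => X.erase c) (fun Y => insert c Y) ?_ ?_ ?_ ?_ ?_
      · intro X hX
        simp only [Finset.mem_filter, Finset.mem_univ, true_and] at hX ⊢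
        exact hX.1
      · intro Y hY
        simp only [Finset.mem_filter, Finset.mem_univ, true_and] at hY ⊢
        refine ⟨?_, Finset.mem_insert_self c Y⟩
        rw [Finset.erase_insert (fun h => Finset.notMem_erase c C (hY h))]
        exact hY
      · intro X hX
        simp only [Finset.mem_filter, Finset.mem_univ, true_and] at hX
        exact Finset.insert_erase hX.2
      · intro Y hY
        simp only [Finset.mem_filter, Finset.mem_univ, true_and] at hY
        exact Finset.erase_insert (fun h => Finset.notMem_erase c C (hY h))
      · intro X _
        rfl
    rw [hre, sum_ite_subset_prod_smallInd_eq_one, mul_one]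
  · rw [if_neg hc]
    refine Finset.sum_eq_zero fun X _ => ?_
    by_cases hcX : c ∈ X
    · rw [if_pos hcX, if_neg (fun h => hc (h hcX))]
    · rw [if_neg hcX]

variable {Y : Type*} [MeasurableSpace Y]

/-- the mixed-polarity sharp product of a term is jointly measurable in (threshold vector, field point) for measurable tested variables. [folklore] -/
theorem measurable_prod_fac_smallInd_eval (A : Finset ι) (pol : ι → Pol) {u : ι → Y → ℝ} (hu : ∀ c ∈ A, Measurable (u c)) :
    Measurable fun p : (ι → ℝ) × Y => ∏ c ∈ A, (pol c).fac (smallInd (u c p.2) (p.1 c)) := by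
  refine Finset.measurable_prod _ fun c hc => (Pol.measurable_fac (pol c)).comp ?_
  unfold smallInd
  refine Measurable.ite ?_ measurable_const measurable_const
  exact measurableSet_lt ((hu c hc).comp measurable_snd) ((measurable_pi_apply c).comp measurable_fst)

/-- **JOINT INTEGRABILITY** of `(S, v) ↦ (∏_{c ∈ A} (pol c).fac 1[u_c v < S_c]) · R v` on (box) × (field space): a `[0, 1]`-valued measurable factor times an
integrable remainder over a finite box. [folklore] -/
theorem integrable_commonBox_fac_integrand (μ : Measure Y) [SFinite μ] (A : Finset ι) (pol : ι → Pol) {u : ι → Y → ℝ}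
    (hu : ∀ c ∈ A, Measurable (u c)) {R : Y → ℝ} (hR : Integrable R μ) (lo hi : ι → ℝ) [Fintype ι] :
    Integrable (Function.uncurry fun (S : ι → ℝ) (v : Y) => (∏ c ∈ A, (pol c).fac (smallInd (u c v) (S c))) * R v)
      ((Measure.pi fun c : ι => volume.restrict (Icc (lo c) (hi c))).prod μ) := by
  have hR2 : Integrable (fun p : (ι → ℝ) × Y => R p.2)
      ((Measure.pi fun c : ι => volume.restrict (Icc (lo c) (hi c))).prod μ) :=
    hR.comp_snd (Measure.pi fun c : ι => volume.restrict (Icc (lo c) (hi c)))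
  refine hR2.norm.mono' ((measurable_prod_fac_smallInd_eval A pol hu).aestronglyMeasurable.mul hR2.aestronglyMeasurable)
    (ae_of_all _ fun p => ?_)
  obtain ⟨S, v⟩ := p
  have h01 := prod_fac_smallInd_mem_unitInterval A pol (fun c => u c v) S
  show ‖(∏ c ∈ A, (pol c).fac (smallInd (u c v) (S c))) * R v‖ ≤ ‖R v‖
  rw [norm_mul, Real.norm_of_nonneg h01.1]
  exact mul_le_of_le_one_left (norm_nonneg _) h01.2

variable [Fintype ι] [DecidableEq ι]

omit [MeasurableSpace Y] in
/-- ★ **THE COMMON-BOX AVERAGE OF A MIXED-POLARITY SHARP PRODUCT IS THE (η)-PROFILED PRODUCT.**  Occurrences `c : ι` (ALL characteristic-function slots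
of the step), one threshold coordinate per occurrence with window `[(1 − κ_c)θ_c, θ_c]` (`0 < κ_c`, `0 < θ_c`), a label reading the sub-family `A` with
tested values `u_c` and polarities `pol c`.  Then `(∏_c κ_cθ_c)⁻¹ · ∫ ∏_{c ∈ A} (pol c).fac 1[u_c < S_c] d(⊗_c Leb|window_c)(S) = ∏_{c ∈ A} (pol c).fac (linProfile κ_c (u_c∕θ_c))`
— small-field slots average to the profile, large-field slots to its complement; unread coordinates cancel (13a's `commonBox_average_prod_smallInd_eq` is
`pol ≡ small`). [folklore] -/
theorem commonBox_average_prod_fac_smallInd_eq (A : Finset ι) (pol : ι → Pol) (κ θ u : ι → ℝ) (hκ : ∀ c, 0 < κ c)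
    (hθ : ∀ c, 0 < θ c) :
    (∏ c, (κ c * θ c))⁻¹ *
        ∫ S, ∏ c ∈ A, (pol c).fac (smallInd (u c) (S c))
          ∂(Measure.pi fun c => volume.restrict (Icc ((1 - κ c) * θ c) (θ c)))
      = ∏ c ∈ A, (pol c).fac (linProfile (κ c) (u c / θ c)) := by
  have hprod : ∀ S : ι → ℝ, ∏ c ∈ A, (pol c).fac (smallInd (u c) (S c)) =
      ∏ c, (if c ∈ A then (pol c).fac (smallInd (u c) (S c)) else 1) := by
    intro S
    rw [Finset.prod_ite_mem, Finset.univ_inter]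
  simp_rw [hprod]
  rw [MeasureTheory.integral_fintype_prod_eq_prod (𝕜 := ℝ) (E := fun _ => ℝ)
    (fun c s => if c ∈ A then (pol c).fac (smallInd (u c) s) else 1)]
  have hfac : ∀ c, (∫ s in Icc ((1 - κ c) * θ c) (θ c), (if c ∈ A then (pol c).fac (smallInd (u c) s) else 1)) =
      κ c * θ c * (if c ∈ A then (pol c).fac (linProfile (κ c) (u c / θ c)) else 1) := by
    intro c
    by_cases hc : c ∈ A
    · simp only [hc, if_true]
      exact integral_fac_smallInd (pol c) (hκ c) (hθ c) (u c)
    · simp only [hc, if_false, mul_one]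
      exact integral_one_window (hκ c) (hθ c)
  simp_rw [hfac]
  have hsplit : (∏ c, (κ c * θ c * (if c ∈ A then (pol c).fac (linProfile (κ c) (u c / θ c)) else 1))) =
      (∏ c, (κ c * θ c)) * ∏ c, (if c ∈ A then (pol c).fac (linProfile (κ c) (u c / θ c)) else 1) :=
    Finset.prod_mul_distrib
  rw [hsplit, ← mul_assoc,
    inv_mul_cancel₀ (Finset.prod_ne_zero_iff.2 fun c _ => (mul_pos (hκ c) (hθ c)).ne'), one_mul,
    Finset.prod_ite_mem, Finset.univ_inter]

/-- ★ **THE `hXs`∕`hA` PAIR FOR MIXED POLARITIES: the normalised common-box average of a threshold-free SHARP WEIGHT is the PROFILED WEIGHT.**  For measurable tested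
variables `u_c` (`c ∈ A`), polarities `pol c`, an integrable remainder `R` under an s-finite field law `μ`, windows with `0 < κ_c`, `0 < θ_c`:
`(∏_c κ_cθ_c)⁻¹ ∫ (∫ (∏_{c ∈ A} (pol c).fac 1[u_c v < S_c]) R v ∂μ) d(box)(S) = ∫ (∏_{c ∈ A} (pol c).fac (linProfile κ_c (u_c v∕θ_c))) R v ∂μ` (one Fubini swap; 13a's
`commonBox_average_weight_eq` is `pol ≡ small`). [folklore] -/
theorem commonBox_average_facWeight_eq (μ : Measure Y) [SFinite μ] (A : Finset ι) (pol : ι → Pol) (κ θ : ι → ℝ) {u : ι → Y → ℝ}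
    (hu : ∀ c ∈ A, Measurable (u c)) {R : Y → ℝ} (hR : Integrable R μ) (hκ : ∀ c, 0 < κ c) (hθ : ∀ c, 0 < θ c) :
    (∏ c, (κ c * θ c))⁻¹ *
        ∫ S, (∫ v, (∏ c ∈ A, (pol c).fac (smallInd (u c v) (S c))) * R v ∂μ)
          ∂(Measure.pi fun c => volume.restrict (Icc ((1 - κ c) * θ c) (θ c)))
      = ∫ v, (∏ c ∈ A, (pol c).fac (linProfile (κ c) (u c v / θ c))) * R v ∂μ := by
  set C : ℝ := ∏ c, (κ c * θ c) with hC
  have hCpos : 0 < C := Finset.prod_pos fun c _ => mul_pos (hκ c) (hθ c)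
  have hswap := integral_integral_swap
    (integrable_commonBox_fac_integrand μ A pol hu hR (fun c => (1 - κ c) * θ c) (fun c => θ c))
  rw [hswap]
  have hinner : (fun v => ∫ S, (∏ c ∈ A, (pol c).fac (smallInd (u c v) (S c))) * R v
      ∂(Measure.pi fun c => volume.restrict (Icc ((1 - κ c) * θ c) (θ c)))) =
      fun v => C * ((∏ c ∈ A, (pol c).fac (linProfile (κ c) (u c v / θ c))) * R v) := by
    funext v
    have hav := commonBox_average_prod_fac_smallInd_eq A pol κ θ (fun c => u c v) hκ hθ
    rw [← hC] at hav
    have hI : ∫ S, ∏ c ∈ A, (pol c).fac (smallInd (u c v) (S c))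
        ∂(Measure.pi fun c => volume.restrict (Icc ((1 - κ c) * θ c) (θ c))) =
        C * ∏ c ∈ A, (pol c).fac (linProfile (κ c) (u c v / θ c)) := by
      rw [← hav, ← mul_assoc, mul_inv_cancel₀ hCpos.ne', one_mul]
    rw [integral_mul_const, hI]
    ring
  rw [hinner, integral_const_mul, ← mul_assoc, inv_mul_cancel₀ hCpos.ne', one_mul]

end MixedPolarity

/-! ## §2 The 𝐓-operation's (3.3) factor is the sharp indicator of a finite bond-sup; (3.2)∕(3.3) label weights as diagonals -/

section Sect3

open B14.Sect3Decomp

variable {P : Params} {G : Type*} [GaugeGroup G] {k : ℕ} (D : Sect3Data P G k) (av : ∀ j, Averaging P j G)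

/-- The bond-sup `sup_{b ∈ (□′^{∼2})^{(k)*}} |V_k(b)(V^{(k)}_{□′}(b))⁻¹ − 1|` is nonnegative (empty sup `= 0` included). [folklore] -/
theorem iSup_dist1_bond_nonneg (c : D.Cube1) (Vk : GaugeField P k G) (V : GaugeField P (k + 1) G) :
    0 ≤ ⨆ b : ↥(D.bondsStar c), dist1 (Vk b.1 * (Vbox D av c V b.1)⁻¹) :=
  Real.iSup_nonneg fun _ => GaugeGroup.dist1_nonneg _

/-- Every bond variable of the block is dominated by the bond-sup. [folklore] -/
theorem dist1_le_iSup_dist1_bond (c : D.Cube1) (Vk : GaugeField P k G) (V : GaugeField P (k + 1) G) {b : PBond P k}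
    (hb : b ∈ D.bondsStar c) :
    dist1 (Vk b * (Vbox D av c V b)⁻¹) ≤ ⨆ b' : ↥(D.bondsStar c), dist1 (Vk b'.1 * (Vbox D av c V b'.1)⁻¹) :=
  le_ciSup (Finite.bddAbove_range fun b' : ↥(D.bondsStar c) => dist1 (Vk b'.1 * (Vbox D av c V b'.1)⁻¹)) (⟨b, hb⟩ : ↥(D.bondsStar c))

/-- ★ **(3.3)'s SMALL-APPROXIMATE-FLUCTUATION CONDITION IS «BOND-SUP BELOW THRESHOLD».**  For `0 < 2δ` (print: `δ_k = g_kA₁∕(A₀p₀(g_k)) > 0`):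
`SmallApproxFluct D av (2δ) V_k V □′ ⟺ ⨆_{b ∈ bondsStar □′} |V_k(b)(V^{(k)}_{□′}(b))⁻¹ − 1| < 2δ` (for an empty bond set both sides hold). [cite: Balaban1988Convergent, (3.3) p.265] -/
theorem smallApproxFluct_iff_iSup_lt {twoδ : ℝ} (hδ : 0 < twoδ) (c : D.Cube1) (Vk : GaugeField P k G) (V : GaugeField P (k + 1) G) :
    SmallApproxFluct D av twoδ Vk V c ↔ (⨆ b : ↥(D.bondsStar c), dist1 (Vk b.1 * (Vbox D av c V b.1)⁻¹)) < twoδ := by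
  constructor
  · intro hall
    rcases isEmpty_or_nonempty (↥(D.bondsStar c)) with he | hne
    · rw [Real.iSup_of_isEmpty]
      exact hδ
    · obtain ⟨b, hb⟩ := exists_eq_ciSup_of_finite (f := fun b' : ↥(D.bondsStar c) => dist1 (Vk b'.1 * (Vbox D av c V b'.1)⁻¹))
      rw [← hb]
      exact hall b.1 b.2
  · intro hlt b hb
    exact (dist1_le_iSup_dist1_bond D av c Vk V hb).trans_lt hlt

open Classical in
/-- ★ **THE (3.3) SMALL-FIELD FUNCTION IS A SHARP SLOT PRODUCT.**  For `0 < 2δ`: `χ′_k(X)(V_k, V) = ∏_{□′ ∈ X} smallInd (u′_{□′}(V_k, V)) (2δ)` with the THRESHOLD-FREE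
tested variables `u′_{□′}(V_k, V) = ⨆_{b ∈ bondsStar □′} dist1 (V_k b · (Vbox D av □′ V b)⁻¹)` — r11's `chiPrime` in the K5 readings' letter; replacing the constant
`2δ` by a vector `S □′` gives the sharp family the mixture road averages. [cite: Balaban1988Convergent, (3.3) p.265] -/
theorem chiPrime_eq_prod_smallInd {twoδ : ℝ} (hδ : 0 < twoδ) (X : Finset D.Cube1) (Vk : GaugeField P k G)
    (V : GaugeField P (k + 1) G) :
    chiPrime D av twoδ X Vk V = ∏ c ∈ X, smallInd (⨆ b : ↥(D.bondsStar c), dist1 (Vk b.1 * (Vbox D av c V b.1)⁻¹)) twoδ := by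
  unfold chiPrime smallInd
  refine Finset.prod_congr rfl fun c _ => ?_
  by_cases h : SmallApproxFluct D av twoδ Vk V c
  · rw [if_pos h, if_pos ((smallApproxFluct_iff_iSup_lt D av hδ c Vk V).1 h)]
  · rw [if_neg h, if_neg (fun h' => h ((smallApproxFluct_iff_iSup_lt D av hδ c Vk V).2 h'))]

open Classical in
/-- … and the (3.3) LARGE-FIELD function `χ′ᶜ_k(X) = ∏_{□′ ∈ X} (1 − smallInd (u′_{□′}) (2δ))`. [cite: Balaban1988Convergent, (3.3) p.265] -/
theorem chiPrimec_eq_prod_one_sub_smallInd {twoδ : ℝ} (hδ : 0 < twoδ) (X : Finset D.Cube1) (Vk : GaugeField P k G)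
    (V : GaugeField P (k + 1) G) :
    chiPrimec D av twoδ X Vk V =
      ∏ c ∈ X, (1 - smallInd (⨆ b : ↥(D.bondsStar c), dist1 (Vk b.1 * (Vbox D av c V b.1)⁻¹)) twoδ) := by
  unfold chiPrimec smallInd
  refine Finset.prod_congr rfl fun c _ => ?_
  by_cases h : SmallApproxFluct D av twoδ Vk V c
  · rw [if_pos h, if_pos ((smallApproxFluct_iff_iSup_lt D av hδ c Vk V).1 h)]
    ring
  · rw [if_neg h, if_neg (fun h' => h ((smallApproxFluct_iff_iSup_lt D av hδ c Vk V).2 h'))]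
    ring

/-- ★ **THE (3.3) LABEL WEIGHT IS THE DIAGONAL OF THE MIXED-POLARITY SHARP PRODUCT.**  For a label `Q ⊆ C` (print: `Q_{k+1}` inside the (3.3) range
`C = (B^{k+1}(P¹_{k+1}))^{∼−1}`) and `0 < 2δ`: `χ′_k(C∖Q)·χ′ᶜ_k(Q) = ∏_{□′ ∈ C} (if □′ ∈ Q then large else small).fac (smallInd (u′_{□′}) (2δ))` — every cube of the
range is one slot with ITS OWN threshold coordinate, read here at the constant vector `S ≡ 2δ`. [cite: Balaban1988Convergent, (3.3) p.265] -/
theorem chiPrime_sdiff_mul_chiPrimec_eq_prod_fac {twoδ : ℝ} (hδ : 0 < twoδ) {C Q : Finset D.Cube1} (hQ : Q ⊆ C)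
    (Vk : GaugeField P k G) (V : GaugeField P (k + 1) G) :
    chiPrime D av twoδ (C \ Q) Vk V * chiPrimec D av twoδ Q Vk V =
      ∏ c ∈ C, (if c ∈ Q then Pol.large else Pol.small).fac
        (smallInd (⨆ b : ↥(D.bondsStar c), dist1 (Vk b.1 * (Vbox D av c V b.1)⁻¹)) twoδ) := by
  rw [chiPrime_eq_prod_smallInd D av hδ, chiPrimec_eq_prod_one_sub_smallInd D av hδ]
  exact prod_sdiff_mul_prod_eq_prod_fac hQ _

/-- **THE (3.2) SMALL-FIELD FUNCTION IS A SHARP SLOT PRODUCT** at 13a's block-sup tested variable: for `0 < ε_{k+1}η_{k+1}²`,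
`χ_{k+1}(X)(V) = ∏_{□′ ∈ X} smallInd (⨆_{p ∈ plaqT □′} dist1 (U_{k+1,□′}(V)(∂p))) (ε_{k+1}η²)` (13a's `chiSmall_eq_smallInd_iSup` slot by slot). [cite: Balaban1988Convergent, (3.2) p.265] -/
theorem chiNext_eq_prod_smallInd_iSup {εk1 : ℝ} (hε : 0 < εk1 * P.eta (k + 1) ^ 2) (X : Finset D.Cube1)
    (V : GaugeField P (k + 1) G) :
    chiNext D εk1 X V =
      ∏ c ∈ X, smallInd (⨆ p : ↥(D.plaqT c), dist1 (GaugeField.plaqHol (D.UkLoc c V) p.1)) (εk1 * P.eta (k + 1) ^ 2) := by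
  unfold chiNext
  exact Finset.prod_congr rfl fun c _ => chiSmall_eq_smallInd_iSup (Or.inr hε) _

/-- … and the (3.2) LARGE-FIELD function `χᶜ_{k+1}(X) = ∏_{□′ ∈ X} (1 − smallInd (u_{□′}) (ε_{k+1}η²))`. [cite: Balaban1988Convergent, (3.2) p.265] -/
theorem chiNextc_eq_prod_one_sub_smallInd_iSup {εk1 : ℝ} (hε : 0 < εk1 * P.eta (k + 1) ^ 2) (X : Finset D.Cube1)
    (V : GaugeField P (k + 1) G) :
    chiNextc D εk1 X V =
      ∏ c ∈ X, (1 - smallInd (⨆ p : ↥(D.plaqT c), dist1 (GaugeField.plaqHol (D.UkLoc c V) p.1)) (εk1 * P.eta (k + 1) ^ 2)) := by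
  unfold chiNextc
  exact Finset.prod_congr rfl fun c _ => by rw [chiSmall_eq_smallInd_iSup (Or.inr hε)]

/-- ★ **THE (3.2) LABEL WEIGHT IS THE DIAGONAL OF THE MIXED-POLARITY SHARP PRODUCT.**  For a label `X ⊆ C` (print: `P_{k+1}` inside the (3.2) range
`C = (Z̃_k^{∼4})ᶜ`) and `0 < ε_{k+1}η²`: `χ_{k+1}(C∖X)·χᶜ_{k+1}(X) = ∏_{□′ ∈ C} (if □′ ∈ X then large else small).fac (smallInd (u_{□′}) (ε_{k+1}η²))`.
[cite: Balaban1988Convergent, (3.2) p.265] -/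
theorem chiNext_sdiff_mul_chiNextc_eq_prod_fac [DecidableEq D.Cube1] {εk1 : ℝ} (hε : 0 < εk1 * P.eta (k + 1) ^ 2)
    {C X : Finset D.Cube1} (hX : X ⊆ C) (V : GaugeField P (k + 1) G) :
    chiNext D εk1 (C \ X) V * chiNextc D εk1 X V =
      ∏ c ∈ C, (if c ∈ X then Pol.large else Pol.small).fac
        (smallInd (⨆ p : ↥(D.plaqT c), dist1 (GaugeField.plaqHol (D.UkLoc c V) p.1)) (εk1 * P.eta (k + 1) ^ 2)) := by
  rw [chiNext_eq_prod_smallInd_iSup D hε, chiNextc_eq_prod_one_sub_smallInd_iSup D hε]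
  convert prod_sdiff_mul_prod_eq_prod_fac hX
    (fun c => smallInd (⨆ p : ↥(D.plaqT c), dist1 (GaugeField.plaqHol (D.UkLoc c V) p.1)) (εk1 * P.eta (k + 1) ^ 2)) using 3

/-- **MEASURABILITY OF THE (3.3) TESTED VARIABLE** along any measurable parametrisation of the two fields (the `meas` binder of the K5 readings for
(3.3)-slots): for a measurably normed gauge group, if `y ↦ V_k(y)` is measurable (product σ-algebra) and `y ↦ V^{(k)}_{□′}(V(y))` is measurable —
DISPLAYED (def-T's (O4): the k-fold average of the localized background `M^k(U_{k+1,□′}(·))` as a measurable map; def-R's (2.12) minimiser has no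
measurable selection in the tree) — then `y ↦ u′_{□′}(V_k(y), V(y))` is measurable: a finite supremum of `dist1 ∘ (eval_b · (eval_b ∘ Vbox)⁻¹)`. [folklore] -/
theorem measurable_iSup_dist1_bond [MeasurableSpace G] [RegularGaugeGroup G] {Y : Type*} [MeasurableSpace Y] (c : D.Cube1)
    {Vk : Y → GaugeField P k G} {V : Y → GaugeField P (k + 1) G} (hVk : Measurable Vk)
    (hVb : Measurable fun y => Vbox D av c (V y)) :
    Measurable fun y => ⨆ b : ↥(D.bondsStar c), dist1 (Vk y b.1 * (Vbox D av c (V y) b.1)⁻¹) := by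
  refine Measurable.iSup fun b => RegularGaugeGroup.measurable_dist1.comp ?_
  exact ((measurable_pi_apply b.1).comp hVk).mul ((measurable_pi_apply b.1).comp hVb).inv

end Sect3

end Summit.QuantumFields.YangMills.Theorems.N21ThresholdMixtureTStepChi

end
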